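/-
Copyright (c) 2026 the pub-hodgecm-mathlib formalisation cell (harness21).  Prover seat hodgecm-mathlib-LH4-p07 (g3), req620 Track A «(D-RAM) FOUR-FRAME» squad
(MS ROAD A, Stage B brick B7 (iv) «CORE-HANGING COUNT», FILE (C): the TUBE REGIME; Stage B lead LH4-p10 (g2), dealer LH4-plan (g11)).  2026-09-04.
-/
import Summits.HodgeConjecture.HodgeConjecture.Theorems.F0P3cDyRamDiagonalCoreHangingOrbits          -- ★ p856021 (A) (this seat): orbits at `s = 0`; brings ★ (iv-a), ★ B7 (i) p855897, ★ TorusDefs, ★ HNF(Exists)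
import Summits.HodgeConjecture.HodgeConjecture.Theorems.F0P3cDyRamDiagonalCoreHangingClasses         -- ★ p856022 (B) (this seat): `ncard_admissible_representatives_eq`
import Summits.HodgeConjecture.HodgeConjecture.Theorems.F0P3cDyRamDiagonalGluedClassRepresentatives  -- ★ (iv-c) LH4-p08 (g2): `exists_fixed_class_representatives`
import Summits.HodgeConjecture.HodgeConjecture.Theorems.F0P3cDyRamDiagonalGluedStabiliserIndexFull   -- ★ (iv-b-idx) LH4-p08 (g2): `ncard_unitTorus_orbit_latt_glued_eq`; brings ★ B5 (iii)∕B7 (iii) p855951 (F0P3-p01 (g31)) `stabiliserWeight_latt_coreHanging_eq`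
import Summits.HodgeConjecture.HodgeConjecture.Theorems.F0P3cDyRamDiagonalGluedStability             -- ★ p855795 B5 (ii) LH4-p10 (g2): `mapGL_latt_hnf_glued_eq_of_depths` (tube ⇒ stable)
import Summits.HodgeConjecture.HodgeConjecture.Theorems.F0P3cDyRamDiagonalStratumTools               -- ★ p855860 LH4-p13 (g2): `stabiliserWeight_mapGL_diagGLUnits`, `finsum_mem_eq_ncard_mul`
import HarnessLib

/-!
# Crux `H413`, MS ROAD A, STAGE B brick B7 (iv), FILE (C): the WEIGHTED COUNT of the CORE-HANGING stratum `H(2ρ)` in the TUBE REGIME `2ρ ≤ n₁, n₂`, `ρ ≤ n₃`: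
# `∑ᶠ_{M ∈ 𝒮_H(ρ)} 1∕[𝒰 : S_F(M)] = (q − 2)·q^{2ρ−1}` (LH4-p10 (g2) MEMO v2 §4 (H); the tube summand of the B10 socket `stub_B7_H`)

Cell `hodgecm-mathlib` (D-0151), FLOOR 0, crux item H413 = `stmt-HodgeConjecture-24833`; lane `--supports stmt-HodgeConjecture-24833 --as helper` (count-neutral).  THEOREMS ONLY
(no `def`, no instance, no notation, no `sorry`, default heartbeats).
THE STRATUM.  `𝒮_H(ρ) := {M ∈ 𝓛₀(T) ∣ M dualisable ∧ ∃ x ζ y″ (|x| = |ζ| = |y″| = |xζ + y″| = 1), M = latt V_H(x, ζ, y″)}`, `V_H(x,ζ,y″) = (1 0 0; x ϖ^ρ 0; xζ+y″ ϖ^ρζ ϖ^{2ρ})`, for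
`T = diag(α, β, 1)` with unit entries and depths `|β − 1| = |ϖ|^{n₁}`, `|α − 1| = |ϖ|^{n₂}`, `|β − α| = |ϖ|^{n₃}`.
THE MATHEMATICS (orbit–stabiliser, as in ★ (iv) for the glued tubes).  In the tube regime every `V_H`-lattice is `T`-stable (★ B5 (ii) at `s = 0`) and normalised, so
`𝒮_H(ρ) = {dualisable V_H-lattices} = ⨆_{g ∈ R_adm} 𝒯·latt V_H(1,1,g)` where `R ⊇ R_adm = {g : |1 + g| = 1}` is a complete irredundant system of `σ`-fixed units mod `𝔭^ρ` (★ (iv-c) at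
`t = 0`; ★ (A): dualisable ⟺ the class of `κ = y″∕(xζ)` is `F`-rational, each class one `𝒯`-orbit, `κ` a class invariant so the orbits are disjoint; admissible because `|1 + κ| = 1`).
Each orbit has `[𝒯 : S̃] = ((q−1)q^{ρ−1})·((q−1)q^{2ρ−1})` members (★ (iv-b-idx) at `s = 0`) of the same weight `1∕[𝒰 : S_F] = (((q−1)q^{⌈ρ∕2⌉−1})·((q−1)q^{ρ−1}))⁻¹` (★ B7 (iii)), and
`#R_adm = (q−2)·q^{⌈ρ∕2⌉−1}` (★ (B)); the product is `(q − 2)·q^{2ρ−1}`.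
* §1 `coreHangingStratum_eq_iUnion_orbits` (the decomposition), `pairwise_disjoint_orbits`, `finsum_stabiliserWeight_orbit_eq`.
* §2 **`finsum_stabiliserWeight_coreHangingStratum_tube`** — the head.
HONEST LABEL.  Count-neutral; the census laws stay PROVER TARGETS until the MS assembly lands; `HC_CM` is proved only modulo the 7 printed citations (2 remaining named inputs:
hLiu418 = `stmt-HodgeConjecture-24832`, h413 = `stmt-HodgeConjecture-24833`) until rung 0 closes.

## References
* [Kottwitz1986BaseChangeUnits] R. Kottwitz, *Base change for unit elements of Hecke algebras*, Compositio Math. 60 (1986), §1 pp. 240–241 (lattice counts via torus orbits).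
* [Rogawski1990] J. D. Rogawski, *Automorphic Representations of Unitary Groups in Three Variables*, Ann. of Math. Stud. 123 (1990), §4.9 Prop. 4.9.1 (a) p. 55.
* [Serre1980Trees] J.-P. Serre, *Trees*, Springer (1980), Ch. II §1.1 (lattices `g·𝒪^N`, Hermite normal forms).
-/

set_option autoImplicit false

noncomputable section

namespace Summit.HodgeConjecture.HodgeConjecture.Cruxes.H413.F0P3cDyRamDiagonalCoreHangingCount

open Matrix
open Literature.NumberTheory.Automorphic Literature.NumberTheory.Automorphic.HermitianLattice
open Literature.NumberTheory.Automorphic.UnitaryLatticeTree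
open Summit.HodgeConjecture.HodgeConjecture.Cruxes.H413.F0P3cDyRamDiagonalTorusDefs
open Summit.HodgeConjecture.HodgeConjecture.Cruxes.H413.F0P3cDyRamDiagonalGluedTorusOrbits
open Summit.HodgeConjecture.HodgeConjecture.Cruxes.H413.F0P3cDyRamDiagonalCoreHangingOrbits
open Summit.HodgeConjecture.HodgeConjecture.Cruxes.H413.F0P3cDyRamDiagonalCoreHangingClasses
open Summit.HodgeConjecture.HodgeConjecture.Cruxes.H413.F0P3cDyRamDiagonalGluedClassRepresentatives
open Summit.HodgeConjecture.HodgeConjecture.Cruxes.H413.F0P3cDyRamDiagonalGluedStabiliserIndex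
open Summit.HodgeConjecture.HodgeConjecture.Cruxes.H413.F0P3cDyRamDiagonalGluedStabiliserIndexFull
open Summit.HodgeConjecture.HodgeConjecture.Cruxes.H413.F0P3cDyRamDiagonalGluedStability
open Summit.HodgeConjecture.HodgeConjecture.Cruxes.H413.F0P3cDyRamDiagonalStratumTools
open scoped Valued WithZero Matrix MatrixGroups

variable {K : Type*} [Field K] [Valued K ℤᵐ⁰]

/-! ## §1 The stratum is a disjoint union of unit-torus orbits indexed by the admissible representatives -/

/-- Every core-hanging frame lattice is NORMALISED (rows contain the units `1`, `x`, `xζ + y″`; all entries integral). [cite: Serre1980Trees, Ch. II §1.1] -/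
theorem isNormalisedLattice_latt_coreHanging {ϖ : K} (hϖ1 : Valued.v ϖ ≤ 1) (ρ : ℕ) {x ζ y'' : K} (hx : Valued.v x = 1) (hζ : Valued.v ζ = 1)
    (hy : Valued.v (x * ζ + y'') = 1) :
    IsNormalisedLattice (latt (!![1, 0, 0; x, ϖ ^ ρ, 0; x * ζ + y'', ϖ ^ ρ * ζ, ϖ ^ (2 * ρ)] : Matrix (Fin 3) (Fin 3) K)) := by
  have hp : Valued.v (ϖ ^ ρ) ≤ 1 := by rw [map_pow]; exact pow_le_one₀ zero_le hϖ1
  have hr : Valued.v (ϖ ^ (2 * ρ)) ≤ 1 := by rw [map_pow]; exact pow_le_one₀ zero_le hϖ1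
  have hz : Valued.v (ϖ ^ ρ * ζ) ≤ 1 := by rw [map_mul, hζ, mul_one]; exact hp
  exact (F0P3cDyRamDiagonalStableLatticeHNF.normalised_latt_hnf_iff hx.le hy.le hz hp hr).2 ⟨Or.inr hx, Or.inr (Or.inl hy)⟩

/-- **THE TUBE-REGIME DECOMPOSITION OF THE CORE-HANGING STRATUM INTO `𝒯`-ORBITS.**  Datum letters `hσ hvσ`, `ϖ` a uniformiser with the wild trace bound, `T = diag(α, β, 1)` with unit
entries and depths `n₁ n₂ n₃`, TUBE hypotheses `2ρ ≤ n₁`, `2ρ ≤ n₂`, `ρ ≤ n₃` (`ρ ≥ 1`); `R` any complete irredundant system of `σ`-fixed units modulo `𝔭^ρ`.  Then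
`𝒮_H(ρ) = ⋃_{g ∈ R, |1+g| = 1} 𝒯·latt V_H(1, 1, g)`. [cite: Kottwitz1986BaseChangeUnits, §1 pp. 240–241] [cite: Rogawski1990, §4.9 Prop. 4.9.1 (a) p. 55] -/
theorem coreHangingStratum_eq_iUnion_orbits {σ : K →+* K} (hσ : ∀ a, σ (σ a) = a) (hvσ : ∀ a, Valued.v (σ a) = Valued.v a)
    {ϖ : K} (hϖ : Valued.v ϖ = WithZero.exp (-1 : ℤ)) (hTr : ∀ a : K, Valued.v (a + σ a) ≤ Valued.v ϖ * Valued.v a)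
    (T : GL (Fin 3) K) {α β : K} (hT : (T : Matrix (Fin 3) (Fin 3) K) = Matrix.diagonal ![α, β, 1]) (hα : Valued.v α = 1) (hβ : Valued.v β = 1)
    {n₁ n₂ n₃ : ℕ} (h₁ : Valued.v (β - 1) = Valued.v ϖ ^ n₁) (h₂ : Valued.v (α - 1) = Valued.v ϖ ^ n₂) (h₃ : Valued.v (β - α) = Valued.v ϖ ^ n₃)
    {ρ : ℕ} (hρ : 1 ≤ ρ) (hρ₁ : 2 * ρ ≤ n₁) (hρ₂ : 2 * ρ ≤ n₂) (hρ₃ : ρ ≤ n₃)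
    {R : Set K} (hR1 : ∀ g ∈ R, σ g = g ∧ Valued.v g = 1) (hR2 : ∀ f : K, σ f = f → Valued.v f = 1 → ∃ g ∈ R, Valued.v (f - g) ≤ Valued.v ϖ ^ ρ) :
    {M : Submodule 𝒪[K] (Fin 3 → K) | M ∈ normalisedStableLattices T ∧ IsDualisableLattice σ ϖ M ∧
        ∃ x ζ y'' : K, Valued.v x = 1 ∧ Valued.v ζ = 1 ∧ Valued.v y'' = 1 ∧ Valued.v (x * ζ + y'') = 1 ∧
          M = latt (!![1, 0, 0; x, ϖ ^ ρ, 0; x * ζ + y'', ϖ ^ ρ * ζ, ϖ ^ (2 * ρ)] : Matrix (Fin 3) (Fin 3) K)} =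
      ⋃ g ∈ {g : K | g ∈ R ∧ Valued.v (1 + g) = 1},
        {M | ∃ u ∈ unitTorus K 3, M = mapGL (diagGLUnits u) (latt (!![1, 0, 0; 1, ϖ ^ ρ, 0; 1 * 1 + g, ϖ ^ ρ * 1, ϖ ^ (2 * ρ)] : Matrix (Fin 3) (Fin 3) K))} := by
  obtain ⟨hϖ0, hϖ1⟩ := ne_zero_and_v_lt_one_of_v_eq_exp hϖ
  have hpρ : ϖ ^ ρ ≠ 0 := pow_ne_zero _ hϖ0
  have hpr : ϖ ^ (2 * ρ) ≠ 0 := pow_ne_zero _ hϖ0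
  ext M
  simp only [Set.mem_setOf_eq, Set.mem_iUnion, exists_prop]
  constructor
  · rintro ⟨-, hdual, x, ζ, y'', hx, hζ, hy'', hy, rfl⟩
    obtain ⟨V, hV⟩ := exists_gl_coe_eq_glued x ζ y'' hpρ hpr
    rw [← hV] at hdual
    obtain ⟨f, hσf, hκf⟩ := (isDualisableLattice_latt_coreHanging_iff_exists_fixed_kappa hσ hvσ hϖ0 hϖ1 hTr ρ hρ hx hζ hy'' hy V hV).1 hdual
    obtain ⟨hvf, -⟩ := fixed_kappa_unit_letters hϖ1 hρ hx hζ hy'' hy hκf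
    obtain ⟨g, hgR, hfg⟩ := hR2 f hσf hvf
    have hκg : Valued.v (y'' / (x * ζ) - g) ≤ Valued.v ϖ ^ ρ := by
      have e : y'' / (x * ζ) - g = (y'' / (x * ζ) - f) + (f - g) := by ring
      rw [e]; exact Valuation.map_add_le _ hκf hfg
    have h1g : Valued.v (1 + g) = 1 :=
      v_one_add_eq_one_of_near (v_one_add_kappa_eq_one hx hζ hy) (hκg.trans_lt (v_pow_lt_one hϖ1 hρ))
    obtain ⟨V₀, hV₀⟩ := exists_gl_coe_eq_glued (1 : K) 1 g hpρ hpr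
    obtain ⟨u, hu, hM⟩ := exists_mem_unitTorus_latt_coreHanging_eq_mapGL hϖ0 ρ hx hζ hy h1g hκg V₀ hV₀
    exact ⟨g, ⟨hgR, h1g⟩, u, hu, by rw [hM, hV₀]⟩
  · rintro ⟨g, ⟨hgR, h1g⟩, u, hu, rfl⟩
    obtain ⟨hσg, hvg⟩ := hR1 g hgR
    obtain ⟨V₀, hV₀⟩ := exists_gl_coe_eq_glued (1 : K) 1 g hpρ hpr
    obtain ⟨x', ζ', y₁, hx', hζ', hy₁, hy', hκ, hM⟩ := exists_coreHanging_of_mem_orbit u hu hvg h1g (ϖ ^ ρ) (ϖ ^ (2 * ρ)) V₀ hV₀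
    rw [← hV₀, hM]
    obtain ⟨V, hV⟩ := exists_gl_coe_eq_glued x' ζ' y₁ hpρ hpr
    refine ⟨⟨⟨V, by rw [hV]⟩, ?_, isNormalisedLattice_latt_coreHanging hϖ1.le ρ hx' hζ' hy'⟩, ?_, x', ζ', y₁, hx', hζ', hy₁, hy', rfl⟩
    · -- `T`-stable: the tube (★ B5 (ii) at `s = 0`)
      have hV0 : (V : Matrix (Fin 3) (Fin 3) K) = !![1, 0, 0; x', ϖ ^ ρ, 0; x' * ζ' + y₁, ϖ ^ ρ * ζ', ϖ ^ (2 * ρ + 0)] := by rw [Nat.add_zero]; exact hV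
      have h := mapGL_latt_hnf_glued_eq_of_depths hϖ0 hϖ1.le hα hβ T hT h₁ h₂ h₃ ρ 0 (by omega) hρ₂ hρ₃ hx' hζ' (by rw [pow_zero]; exact hy₁) V hV0
      rwa [hV] at h
    · -- dualisable: the class of `κ = g` is `F`-rational
      rw [← hV]
      exact (isDualisableLattice_latt_coreHanging_iff_exists_fixed_kappa hσ hvσ hϖ0 hϖ1 hTr ρ hρ hx' hζ' hy₁ hy' V hV).2
        ⟨g, hσg, by rw [hκ, sub_self, map_zero]; exact zero_le⟩

/-- **THE ORBITS OF DISTINCT REPRESENTATIVES ARE DISJOINT** (`κ` mod `𝔭^ρ` is a lattice invariant, ★ (A), and `R` is irredundant). [cite: Kottwitz1986BaseChangeUnits, §1 pp. 240–241] -/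
theorem pairwise_disjoint_orbits {ϖ : K} (hϖ : Valued.v ϖ = WithZero.exp (-1 : ℤ)) (ρ : ℕ) {R : Set K} (hR1 : ∀ g ∈ R, Valued.v g = 1)
    (hR3 : ∀ g ∈ R, ∀ g' ∈ R, Valued.v (g - g') ≤ Valued.v ϖ ^ ρ → g = g') :
    {g : K | g ∈ R ∧ Valued.v (1 + g) = 1}.PairwiseDisjoint (fun g : K =>
      {M : Submodule 𝒪[K] (Fin 3 → K) | ∃ u ∈ unitTorus K 3, M = mapGL (diagGLUnits u) (latt (!![1, 0, 0; 1, ϖ ^ ρ, 0; 1 * 1 + g, ϖ ^ ρ * 1, ϖ ^ (2 * ρ)] : Matrix (Fin 3) (Fin 3) K))}) := by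
  obtain ⟨hϖ0, hϖ1⟩ := ne_zero_and_v_lt_one_of_v_eq_exp hϖ
  have hpρ : ϖ ^ ρ ≠ 0 := pow_ne_zero _ hϖ0
  have hpr : ϖ ^ (2 * ρ) ≠ 0 := pow_ne_zero _ hϖ0
  intro g hg g' hg' hne
  rw [Function.onFun, Set.disjoint_left]
  rintro M ⟨u, hu, rfl⟩ ⟨u', hu', hM⟩
  apply hne
  obtain ⟨V₀, hV₀⟩ := exists_gl_coe_eq_glued (1 : K) 1 g hpρ hpr
  obtain ⟨V₀', hV₀'⟩ := exists_gl_coe_eq_glued (1 : K) 1 g' hpρ hpr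
  obtain ⟨x₁, ζ₁, y₁, hx₁, hζ₁, hy₁, -, hκ₁, h₁⟩ := exists_coreHanging_of_mem_orbit u hu (hR1 _ hg.1) hg.2 (ϖ ^ ρ) (ϖ ^ (2 * ρ)) V₀ hV₀
  obtain ⟨x₂, ζ₂, y₂, hx₂, hζ₂, -, -, hκ₂, h₂⟩ := exists_coreHanging_of_mem_orbit u' hu' (hR1 _ hg'.1) hg'.2 (ϖ ^ ρ) (ϖ ^ (2 * ρ)) V₀' hV₀'
  rw [← hV₀, ← hV₀', h₁, h₂] at hM
  have hk := v_kappa_sub_le_of_latt_coreHanging_eq hϖ0 hϖ1.le ρ hx₁ hζ₁ hy₁ hx₂ hζ₂ hM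
  rw [hκ₁, hκ₂] at hk
  exact hR3 _ hg.1 _ hg'.1 hk

/-- **EACH ORBIT CONTRIBUTES `[𝒯 : S̃]∕[𝒰 : S_F]`**: on the orbit `𝒯·latt V_H(1,1,g)` (`g` a `σ`-fixed unit) the weight is the constant of ★ B7 (iii) and the orbit has the ★ (iv-b-idx)
size, so `∑ᶠ_{M ∈ orbit} w(M) = ((q−1)q^{ρ−1})((q−1)q^{2ρ−1}) · (((q−1)q^{⌈ρ∕2⌉−1})((q−1)q^{ρ−1}))⁻¹`. [cite: Kottwitz1986BaseChangeUnits, §1 pp. 240–241] [cite: Rogawski1990, §4.9 Prop. 4.9.1 (a) p. 55] -/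
theorem finsum_stabiliserWeight_orbit_eq {σ : K →+* K} (hσ : ∀ a, σ (σ a) = a) (hvσ : ∀ a, Valued.v (σ a) = Valued.v a)
    (hfix : ∀ x : K, σ x = x → x ≠ 0 → ∃ n : ℤ, Valued.v x = WithZero.exp (2 * n)) {ϖ : K} (hϖ : Valued.v ϖ = WithZero.exp (-1 : ℤ))
    {d : ℕ} (hd : Valued.v (ϖ - σ ϖ) = Valued.v ϖ ^ d) [Finite 𝓀[K]] {ρ : ℕ} (hρ : 1 ≤ ρ) {g : K} (hσg : σ g = g) (hvg : Valued.v g = 1) :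
    ∑ᶠ M ∈ {M : Submodule 𝒪[K] (Fin 3 → K) | ∃ u ∈ unitTorus K 3, M = mapGL (diagGLUnits u) (latt (!![1, 0, 0; 1, ϖ ^ ρ, 0; 1 * 1 + g, ϖ ^ ρ * 1, ϖ ^ (2 * ρ)] : Matrix (Fin 3) (Fin 3) K))},
        stabiliserWeight σ M =
      ((((Nat.card 𝓀[K] - 1) * Nat.card 𝓀[K] ^ (ρ - 1)) * ((Nat.card 𝓀[K] - 1) * Nat.card 𝓀[K] ^ (2 * ρ - 1)) : ℕ) : ℚ) *
        ((((Nat.card 𝓀[K] - 1) * Nat.card 𝓀[K] ^ ((ρ + 1) / 2 - 1)) * ((Nat.card 𝓀[K] - 1) * Nat.card 𝓀[K] ^ (ρ - 1)) : ℕ) : ℚ)⁻¹ := by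
  obtain ⟨hϖ0, hϖ1⟩ := ne_zero_and_v_lt_one_of_v_eq_exp hϖ
  have hq : 1 < Nat.card 𝓀[K] := Finite.one_lt_card
  obtain ⟨V₀, hV₀⟩ := exists_gl_coe_eq_glued (1 : K) 1 g (pow_ne_zero ρ hϖ0) (pow_ne_zero (2 * ρ) hϖ0)
  -- the orbit size (★ (iv-b-idx) at `s = 0`)
  have hV0 : (V₀ : Matrix (Fin 3) (Fin 3) K) = !![1, 0, 0; 1, ϖ ^ ρ, 0; 1 * 1 + g, ϖ ^ ρ * 1, ϖ ^ (2 * ρ + 0)] := by rw [Nat.add_zero]; exact hV₀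
  have hcard := ncard_unitTorus_orbit_latt_glued_eq hϖ hρ 0 (map_one _) (map_one _) (by rw [pow_zero]; exact hvg) V₀ hV0
  rw [Nat.add_zero] at hcard
  rw [← hV₀]
  have hfin : {M : Submodule 𝒪[K] (Fin 3 → K) | ∃ u ∈ unitTorus K 3, M = mapGL (diagGLUnits u) (latt (V₀ : Matrix (Fin 3) (Fin 3) K))}.Finite := by
    refine Set.finite_of_ncard_ne_zero ?_
    rw [hcard]
    exact mul_ne_zero (mul_ne_zero (by omega) (pow_ne_zero _ (by omega))) (mul_ne_zero (by omega) (pow_ne_zero _ (by omega)))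
  rw [finsum_mem_eq_ncard_mul hfin _ _ ?_, hcard]
  rintro M ⟨u, -, rfl⟩
  rw [stabiliserWeight_mapGL_diagGLUnits]
  exact stabiliserWeight_latt_coreHanging_eq hσ hvσ hfix hϖ hd hρ (map_one _) (map_one _) hvg V₀ hV₀ hσg
    (by rw [map_one, one_mul, one_mul, hσg, sub_self, map_zero]; exact zero_le)

/-! ## §2 HEAD — the tube-regime count -/

/-- **B7 (iv), TUBE REGIME — THE WEIGHTED COUNT OF THE CORE-HANGING STRATUM IS `(q − 2)·q^{2ρ−1}`.**  For the ramified quadratic datum letters `hσ hvσ hfix hϖ hd` with the wild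
trace bound `hTr` (★ `WildQuadraticDatumTraceBound` from the datum + `|2| < 1`), a finite residue field (`q = #𝓀`), `T = diag(α, β, 1)` with unit entries and depths
`|β − 1| = |ϖ|^{n₁}`, `|α − 1| = |ϖ|^{n₂}`, `|β − α| = |ϖ|^{n₃}`, and `ρ ≥ 1` with `2ρ ≤ n₁`, `2ρ ≤ n₂`, `ρ ≤ n₃`:
`∑ᶠ_{M ∈ 𝒮_H(ρ)} stabiliserWeight σ M = (q − 2)·q^{2ρ−1}` (MEMO v2 §4 (H); the tube summand of `stub_B7_H`; at `q = 2` both sides are `0`).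
[cite: Rogawski1990, §4.9 Prop. 4.9.1 (a) p. 55] [cite: Kottwitz1986BaseChangeUnits, §1 pp. 240–241] -/
theorem finsum_stabiliserWeight_coreHangingStratum_tube {σ : K →+* K} (hσ : ∀ a, σ (σ a) = a) (hvσ : ∀ a, Valued.v (σ a) = Valued.v a)
    (hfix : ∀ x : K, σ x = x → x ≠ 0 → ∃ n : ℤ, Valued.v x = WithZero.exp (2 * n)) {ϖ : K} (hϖ : Valued.v ϖ = WithZero.exp (-1 : ℤ))
    {d : ℕ} (hd : Valued.v (ϖ - σ ϖ) = Valued.v ϖ ^ d) (hTr : ∀ a : K, Valued.v (a + σ a) ≤ Valued.v ϖ * Valued.v a) [Finite 𝓀[K]]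
    (T : GL (Fin 3) K) {α β : K} (hT : (T : Matrix (Fin 3) (Fin 3) K) = Matrix.diagonal ![α, β, 1]) (hα : Valued.v α = 1) (hβ : Valued.v β = 1)
    {n₁ n₂ n₃ : ℕ} (h₁ : Valued.v (β - 1) = Valued.v ϖ ^ n₁) (h₂ : Valued.v (α - 1) = Valued.v ϖ ^ n₂) (h₃ : Valued.v (β - α) = Valued.v ϖ ^ n₃)
    {ρ : ℕ} (hρ : 1 ≤ ρ) (hρ₁ : 2 * ρ ≤ n₁) (hρ₂ : 2 * ρ ≤ n₂) (hρ₃ : ρ ≤ n₃) :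
    ∑ᶠ M ∈ {M : Submodule 𝒪[K] (Fin 3 → K) | M ∈ normalisedStableLattices T ∧ IsDualisableLattice σ ϖ M ∧
        ∃ x ζ y'' : K, Valued.v x = 1 ∧ Valued.v ζ = 1 ∧ Valued.v y'' = 1 ∧ Valued.v (x * ζ + y'') = 1 ∧
          M = latt (!![1, 0, 0; x, ϖ ^ ρ, 0; x * ζ + y'', ϖ ^ ρ * ζ, ϖ ^ (2 * ρ)] : Matrix (Fin 3) (Fin 3) K)}, stabiliserWeight σ M =
      ((Nat.card 𝓀[K] : ℚ) - 2) * (Nat.card 𝓀[K] : ℚ) ^ (2 * ρ - 1) := by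
  obtain ⟨hϖ0, hϖ1⟩ := ne_zero_and_v_lt_one_of_v_eq_exp hϖ
  have hq : 1 < Nat.card 𝓀[K] := Finite.one_lt_card
  -- representatives of the fixed units mod `𝔭^ρ` (★ (iv-c) at `t = 0`) and the admissible ones (★ (B))
  obtain ⟨R, hRfin, hRcard, hR1, hR2, hR3⟩ := exists_fixed_class_representatives hσ hvσ hfix hϖ hd ρ 0 hρ
  simp only [Nat.mul_zero, pow_zero, Nat.add_zero] at hR1 hR2 hR3
  have hadm := ncard_admissible_representatives_eq hσ hvσ hfix hϖ hd hρ hRfin hRcard hR1 hR2 hR3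
  have hRadmfin : {g : K | g ∈ R ∧ Valued.v (1 + g) = 1}.Finite := hRfin.subset (Set.sep_subset _ _)
  -- decompose and sum orbit by orbit
  rw [coreHangingStratum_eq_iUnion_orbits hσ hvσ hϖ hTr T hT hα hβ h₁ h₂ h₃ hρ hρ₁ hρ₂ hρ₃ hR1 hR2,
    finsum_mem_biUnion (pairwise_disjoint_orbits hϖ ρ (fun g hg => (hR1 g hg).2) hR3) hRadmfin ?_]
  · rw [finsum_mem_eq_ncard_mul hRadmfin _ _ (fun g hg => finsum_stabiliserWeight_orbit_eq hσ hvσ hfix hϖ hd hρ (hR1 _ hg.1).1 (hR1 _ hg.1).2), hadm]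
    -- arithmetic
    have hq1 : ((Nat.card 𝓀[K] : ℚ) - 1) ≠ 0 := by
      have : (1 : ℚ) < Nat.card 𝓀[K] := by exact_mod_cast hq
      linarith
    have hq0 : (Nat.card 𝓀[K] : ℚ) ≠ 0 := by exact_mod_cast (by omega : Nat.card 𝓀[K] ≠ 0)
    have e2 : 2 * ρ - 1 = ρ + (ρ - 1) := by omega
    push_cast [Nat.cast_sub hq.le, Nat.cast_sub (show 2 ≤ Nat.card 𝓀[K] by omega)]
    rw [e2, pow_add]
    field_simp
  · intro g hg
    obtain ⟨V₀, hV₀⟩ := exists_gl_coe_eq_glued (1 : K) 1 g (pow_ne_zero ρ hϖ0) (pow_ne_zero (2 * ρ) hϖ0)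
    have hV0 : (V₀ : Matrix (Fin 3) (Fin 3) K) = !![1, 0, 0; 1, ϖ ^ ρ, 0; 1 * 1 + g, ϖ ^ ρ * 1, ϖ ^ (2 * ρ + 0)] := by rw [Nat.add_zero]; exact hV₀
    have hcard := ncard_unitTorus_orbit_latt_glued_eq hϖ hρ 0 (map_one _) (map_one _) (by rw [pow_zero]; exact (hR1 _ hg.1).2) V₀ hV0
    rw [← hV₀]
    refine Set.finite_of_ncard_ne_zero ?_
    rw [hcard]
    exact mul_ne_zero (mul_ne_zero (by omega) (pow_ne_zero _ (by omega))) (mul_ne_zero (by omega) (pow_ne_zero _ (by omega)))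

end Summit.HodgeConjecture.HodgeConjecture.Cruxes.H413.F0P3cDyRamDiagonalCoreHangingCount

end
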